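import Literature.Computability.Cryptography.ChenQuantumLWEWindowProfile

/-!
# A window placed in register coordinates: the law is the window's law shifted by the unknown centre

REPRODUCTION / ANALYSIS OF A CLAIMED RESULT UNDER ADJUDICATION (withdrawn): Yilei Chen, *Quantum
Algorithms for Lattice Problems*, IACR ePrint 2024/555, version of 2024-04-18 [ChenQuantumLattice2024]
(the version carrying the author's note that Step 9 contains a bug), Step 9 (§3.5.9, pp. 34–38) acting
on `|φ8.b⟩ = Σ_{j ∈ ℤ_P} e(-j²/P) |2D²j·b + v′ mod N⟩` (p. 35), `P = p₁Q`, `N = D²P`.  Bundle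
`papers/QuantumAdvantage/lwe-quantum-autopsy/`, Part 2 (`REPAIR-CENSUS.md` §1 T5/T8 and §10), sequel
of `ChenQuantumLWEWindowProfile.lean` (T9).
HONEST FRAMING: kernel-checked THEOREMS about states occurring in a WITHDRAWN algorithm — a precise
NEGATIVE result (what a window applied without knowledge of the chirp centre does to the law), NOT
summit progress, no cryptanalytic claim in either direction, no new algorithm; quantum lower bounds are
out of scope.

## What is proved

A window (any weight function `w : ℤ_P → ℂ` — an indicator, a narrower Gaussian, the Kraus weight of a
partial measurement) can only be applied to the REGISTER coordinate `X₀ = −2D²j + v′₀`, i.e. at an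
unknown position `j₀` RELATIVE TO THE CHIRP `ψ_P(−j²)` of `|φ8.b⟩` (`j₀` is the chirp centre in window
coordinates: the datum `v′₀ mod P` of `ChenQuantumLWEChirpFourier.centreError`, which Step 8 supplies
only modulo `D²p₁`).  The resulting line profile is `c(j) = ψ_P(−j²)·w(j − j₀)` and:

* `profileDFT_chirpWindow_shift`: `ĉ(s) = ψ_P(j₀s)·ψ_P(−j₀²)·(ψ·w)^(s − 2j₀)` — up to phases, the
  spectrum of the chirped window `ψ_P(−j²)w(j)` translated by `2j₀`.
* `weight_qft_chirpWindow_shift`, **`prob_chirpWindow_shift_eq`**: the Born law of the hyperplane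
  value `t = ⟨b, u mod P⟩` for the window at relative position `j₀` is the law for `j₀ = 0` evaluated
  at `t + j₀` — the whole law is TRANSLATED by the unknown `j₀`.  So even a window whose law
  concentrates (T9: this needs `|S| ≳ P`; T8 exact: interval windows never do) outputs `t = t⋆ − j₀`
  with `j₀` unknown and fresh per run: an LWE-type sample whose error is the uniformly unknown centre —
  T5's "a wrong chirp centre is a shifted hyperplane" for windows (`REPAIR-CENSUS.md` T8 (a)).
* `Shape.prob_chirpWindow_shift_eq`: the same for every admissible shape.

## What is NOT here

How a modified front end would realise a given `w` (the census argues this by hand); any claim about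
`j₀` beyond "it enters only as a translation of the law".
-/

namespace Literature.Computability.Cryptography.Chen2024

open scoped BigOperators

section Profile

variable (p₁ Q : ℕ+)

/-- **Spectrum of a window at relative position `j₀` on the chirp**:
`(ψ(−j²)w(j−j₀))^(s) = ψ_P(j₀s)·ψ_P(−j₀²)·(ψ(−j²)w(j))^(s − 2j₀)`. [folklore] -/
theorem profileDFT_chirpWindow_shift (w : ZP p₁ Q → ℂ) (j₀ s : ZP p₁ Q) :
    profileDFT p₁ Q (fun j => (ZMod.stdAddChar (-(j ^ 2)) : ℂ) * w (j - j₀)) s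
      = ZMod.stdAddChar (j₀ * s) * ((ZMod.stdAddChar (-(j₀ ^ 2)) : ℂ)
          * profileDFT p₁ Q (fun j => (ZMod.stdAddChar (-(j ^ 2)) : ℂ) * w j) (s - 2 * j₀)) := by
  set C : ZP p₁ Q → ℂ := fun j => (ZMod.stdAddChar (-(j₀ ^ 2)) : ℂ)
      * ((ZMod.stdAddChar (j * (-(2 * j₀))) : ℂ) * ((ZMod.stdAddChar (-(j ^ 2)) : ℂ) * w j)) with hC
  have hc : (fun j : ZP p₁ Q => (ZMod.stdAddChar (-(j ^ 2)) : ℂ) * w (j - j₀)) = fun j => C (j - j₀) := by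
    funext j
    simp only [hC]
    rw [← mul_assoc, ← mul_assoc, ← AddChar.map_add_eq_mul, ← AddChar.map_add_eq_mul]
    congr 2
    ring
  rw [hc, profileDFT_translate, hC, profileDFT_const_mul, profileDFT_linPhase, sub_eq_add_neg s]

/-- The shifted chirped window has the same norm as the window. [folklore] -/
theorem sum_norm_sq_chirpWindow (w : ZP p₁ Q → ℂ) (j₀ : ZP p₁ Q) :
    ∑ j, ‖(ZMod.stdAddChar (-(j ^ 2)) : ℂ) * w (j - j₀)‖ ^ 2 = ∑ j, ‖w j‖ ^ 2 :=
  Fintype.sum_equiv (Equiv.subRight j₀) _ _ fun j => by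
    rw [norm_mul, ZMod.stdAddChar_apply, Circle.norm_coe, one_mul, Equiv.subRight_apply]

end Profile

section Line

variable (n : ℕ) (D p₁ Q : ℕ+) (b v' : Fin (n + 1) → ℤ)

/-- **Law of a window at relative position `j₀`**: `|(ψw)^(−2(t(u) + j₀))|²` — the `j₀ = 0` law read at
`t + j₀`. [cite: ChenQuantumLattice2024, §3.5.9 pp. 35–38; folklore] -/
theorem weight_qft_chirpWindow_shift (w : ZP p₁ Q → ℂ) (j₀ : ZP p₁ Q) (u : Fin (n + 1) → ZN D p₁ Q) :
    weight (qft (profileKet n D p₁ Q b v' (fun j => (ZMod.stdAddChar (-(j ^ 2)) : ℂ) * w (j - j₀)))) u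
      = ‖profileDFT p₁ Q (fun j => (ZMod.stdAddChar (-(j ^ 2)) : ℂ) * w j)
          (-(2 * (lineFun n D p₁ Q b u + j₀)))‖ ^ 2 := by
  rw [weight_qft_profileKet, profileDFT_chirpWindow_shift, norm_mul, norm_mul, ZMod.stdAddChar_apply,
    Circle.norm_coe, ZMod.stdAddChar_apply, Circle.norm_coe, one_mul, one_mul,
    show -(2 * lineFun n D p₁ Q b u) - 2 * j₀ = -(2 * (lineFun n D p₁ Q b u + j₀)) by ring]

/-- The probability of the hyperplane value `t` for the window at relative position `j₀`, in closed
form. [cite: ChenQuantumLattice2024, §3.5.9 pp. 35–38; folklore] -/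
theorem prob_chirpWindow_shift (hP : Odd ((p₁ * Q : ℕ+) : ℕ)) (hb : b 0 = -1) (w : ZP p₁ Q → ℂ)
    (hw : ∑ j, ‖w j‖ ^ 2 ≠ 0) (j₀ t : ZP p₁ Q) :
    (∑ u ∈ Finset.univ.filter (fun u : Fin (n + 1) → ZN D p₁ Q => lineFun n D p₁ Q b u = t),
        weight (qft (profileKet n D p₁ Q b v'
          (fun j => (ZMod.stdAddChar (-(j ^ 2)) : ℂ) * w (j - j₀)))) u)
        / ∑ u, weight (qft (profileKet n D p₁ Q b v'
          (fun j => (ZMod.stdAddChar (-(j ^ 2)) : ℂ) * w (j - j₀)))) u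
      = ‖profileDFT p₁ Q (fun j => (ZMod.stdAddChar (-(j ^ 2)) : ℂ) * w j) (-(2 * (t + j₀)))‖ ^ 2
          / ((((p₁ * Q : ℕ+) : ℕ) : ℝ) * ∑ j, ‖w j‖ ^ 2) := by
  have hc : ∑ j, ‖(ZMod.stdAddChar (-(j ^ 2)) : ℂ) * w (j - j₀)‖ ^ 2 ≠ 0 := by
    rwa [sum_norm_sq_chirpWindow]
  rw [prob_lineFun_eq n D p₁ Q b v' hP hb _ hc t, sum_norm_sq_chirpWindow, profileDFT_chirpWindow_shift,
    norm_mul, norm_mul, ZMod.stdAddChar_apply, Circle.norm_coe, ZMod.stdAddChar_apply, Circle.norm_coe,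
    one_mul, one_mul, show -(2 * t) - 2 * j₀ = -(2 * (t + j₀)) by ring]

/-- **The law is translated by the unknown centre.** For every window `w ≠ 0`, every relative position
`j₀` and every value `t`: `Pr_{j₀}[t] = Pr_{0}[t + j₀]`. [cite: ChenQuantumLattice2024, §3.5.9 pp. 35–38; folklore] -/
theorem prob_chirpWindow_shift_eq (hP : Odd ((p₁ * Q : ℕ+) : ℕ)) (hb : b 0 = -1) (w : ZP p₁ Q → ℂ)
    (hw : ∑ j, ‖w j‖ ^ 2 ≠ 0) (j₀ t : ZP p₁ Q) :
    (∑ u ∈ Finset.univ.filter (fun u : Fin (n + 1) → ZN D p₁ Q => lineFun n D p₁ Q b u = t),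
        weight (qft (profileKet n D p₁ Q b v'
          (fun j => (ZMod.stdAddChar (-(j ^ 2)) : ℂ) * w (j - j₀)))) u)
        / ∑ u, weight (qft (profileKet n D p₁ Q b v'
          (fun j => (ZMod.stdAddChar (-(j ^ 2)) : ℂ) * w (j - j₀)))) u
      = (∑ u ∈ Finset.univ.filter (fun u : Fin (n + 1) → ZN D p₁ Q => lineFun n D p₁ Q b u = t + j₀),
          weight (qft (profileKet n D p₁ Q b v'
            (fun j => (ZMod.stdAddChar (-(j ^ 2)) : ℂ) * w (j - 0)))) u)
          / ∑ u, weight (qft (profileKet n D p₁ Q b v'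
            (fun j => (ZMod.stdAddChar (-(j ^ 2)) : ℂ) * w (j - 0)))) u := by
  rw [prob_chirpWindow_shift n D p₁ Q b v' hP hb w hw j₀ t,
    prob_chirpWindow_shift n D p₁ Q b v' hP hb w hw 0 (t + j₀), add_zero]

end Line

end Literature.Computability.Cryptography.Chen2024

namespace Literature.Computability.Cryptography.Chen2024.Shape

open scoped BigOperators

variable (S : Shape)

/-- **Every admissible shape**: a window applied at relative position `j₀` to the chirp of `|φ8.b⟩`
yields the `j₀ = 0` law translated by `j₀`. [cite: ChenQuantumLattice2024, §3.5.9 pp. 35–38; folklore] -/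
theorem prob_chirpWindow_shift_eq (h : S.Admissible) (w : ZP S.p₁ S.Q → ℂ) (hw : ∑ j, ‖w j‖ ^ 2 ≠ 0)
    (j₀ t : ZP S.p₁ S.Q) :
    (∑ u ∈ Finset.univ.filter (fun u : Fin (S.n + 1) → ZMod S.N => lineFun S.n S.D S.p₁ S.Q S.b u = t),
        weight (qft (profileKet S.n S.D S.p₁ S.Q S.b S.v'
          (fun j => (ZMod.stdAddChar (-(j ^ 2)) : ℂ) * w (j - j₀)))) u)
        / ∑ u, weight (qft (profileKet S.n S.D S.p₁ S.Q S.b S.v'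
          (fun j => (ZMod.stdAddChar (-(j ^ 2)) : ℂ) * w (j - j₀)))) u
      = (∑ u ∈ Finset.univ.filter
            (fun u : Fin (S.n + 1) → ZMod S.N => lineFun S.n S.D S.p₁ S.Q S.b u = t + j₀),
          weight (qft (profileKet S.n S.D S.p₁ S.Q S.b S.v'
            (fun j => (ZMod.stdAddChar (-(j ^ 2)) : ℂ) * w (j - 0)))) u)
          / ∑ u, weight (qft (profileKet S.n S.D S.p₁ S.Q S.b S.v'
            (fun j => (ZMod.stdAddChar (-(j ^ 2)) : ℂ) * w (j - 0)))) u :=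
  Chen2024.prob_chirpWindow_shift_eq S.n S.D S.p₁ S.Q S.b S.v' h.odd_P h.b_head w hw j₀ t

end Literature.Computability.Cryptography.Chen2024.Shape
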